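import Summits.QuantumFields.QCD.Theorems.QuarksAsStableActionCriticalLineDiamagnetismCellDefs

/-!
# Walk-expansion vocabulary for the B6 cell sub-stub `cellSecondOrder`
(crux `stmt-QuantumFields-9734`, decl `Summit.QuantumFields.QCD.Theses.QuarksAsStableAction.CriticalLineDiamagnetism`,
line `Sketch`, Route B step B6; sub-problem context `Summits/QuantumFields/QCD/Statement.lean`)

DEFINITIONS ONLY (the analytic files `…CellSecondOrderAux*` import them).  The free 2D frequency operator
`D_1 = freqOpR γ 1 m ω₀ ω₁` on `(ℤ/2n)²` is colour-trivial: `D_1 = sFree ⊗ 1₃` (after regrouping the index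
`(site, colour, spin)` as `((site, spin), colour)` along `csEquiv`), where the SPIN-SITE operator
`sFree L M s₀ s₁ = 1 ⊗ N − h` on `(ℤ/L)² × Fin 4` has the on-site block `N = spinN M s₀ s₁ = M·1 + i(s₀γ₀ + s₁γ₁)`
(`M = bigM m ω₀ ω₁`, `s_i = sin ω_i`) and the seam-signed Wilson hop `h = sHopTot L`
(`h(x, x+e_μ) = σ_μ(x) P₋^μ`, `h(x+e_μ, x) = σ_μ(x) P₊^μ`, antiperiodic seam signs `seam`).  The Neumann ratio
`xHop = (1 ⊗ N⁻¹) h` generates the walk expansion `sFree⁻¹ = Σ_j xHop^j (1 ⊗ N⁻¹)`; its `4 × 4` site blocks are the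
torus walk sums `torusWalk L M s₀ s₁ j u v`, which below the girth equal the planar walk sums `CellKappa.planarWalk` up to
the lift sign `liftSign` (the antiperiodic `ℤ₂` connection is pure gauge on the planar cover `toTorus : ℤ² → (ℤ/L)²`).  `tdist` is the `ℓ¹` torus
distance controlling the locality of `xHop^j`; `freeBlock` are the `4 × 4` blocks of `sFree⁻¹` and `pairAbs x x'` is the
four-term absolute bubble of a pair of first-coordinate links (the torus counterpart of the summand of `CellKappa.bubbleAbs`).
-/

noncomputable section

open scoped BigOperators Matrix Kronecker
open Matrix Literature.MathematicalPhysics.QuantumLattice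

namespace Summit.QuantumFields.QCD.Cruxes.CriticalLineDiamagnetism.ChessboardCellGain.CellWalk

/-- The antiperiodic seam sign of `freqOpR`: `−1` on the links based at coordinate `−1`, else `1`. -/
def seam {L : ℕ} (a : ZMod L) : ℂ := if a = -1 then -1 else 1

/-- The on-site spin block `N = M·1 + i(s₀γ₀ + s₁γ₁)` of the frequency operator. -/
def spinN (M s₀ s₁ : ℝ) : Matrix (Fin 4) (Fin 4) ℂ :=
  ((M : ℝ) : ℂ) • (1 : Matrix (Fin 4) (Fin 4) ℂ) +
    Complex.I • ((((s₀ : ℝ) : ℂ)) • euclideanGamma 0 + ((s₁ : ℝ) : ℂ) • euclideanGamma 1)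

/-- A one-direction seam-signed Wilson hop on the spin-site space `(ℤ/L)² × Fin 4`, in Kronecker form: the block
from `x` to `x + e` is `s(x) P₋^μ`, the block from `x + e` to `x` is `s(x) P₊^μ`. -/
def dirHop (L : ℕ) (e : ZMod L × ZMod L) (s : ZMod L × ZMod L → ℂ) (μ : Fin 4) :
    Matrix ((ZMod L × ZMod L) × Fin 4) ((ZMod L × ZMod L) × Fin 4) ℂ :=
  (Matrix.of fun x y : ZMod L × ZMod L => if y = x + e then s x else 0) ⊗ₖ CellKappa.pMinus μ +
    (Matrix.of fun x y : ZMod L × ZMod L => if x = y + e then s y else 0) ⊗ₖ CellKappa.pPlus μ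

/-- The total hop `h` of the free 2D frequency operator: first coordinate with spin slot `2`, second with slot `3`. -/
def sHopTot (L : ℕ) : Matrix ((ZMod L × ZMod L) × Fin 4) ((ZMod L × ZMod L) × Fin 4) ℂ :=
  dirHop L (1, 0) (fun x => seam x.1) 2 + dirHop L (0, 1) (fun x => seam x.2) 3

/-- The spin-site free frequency operator `1 ⊗ N − h` on `(ℤ/L)² × Fin 4`. -/
def sFree (L : ℕ) (M s₀ s₁ : ℝ) : Matrix ((ZMod L × ZMod L) × Fin 4) ((ZMod L × ZMod L) × Fin 4) ℂ :=
  (1 : Matrix (ZMod L × ZMod L) (ZMod L × ZMod L) ℂ) ⊗ₖ spinN M s₀ s₁ - sHopTot L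

/-- The Neumann ratio `x = (1 ⊗ N⁻¹) h` of the walk expansion `(1 ⊗ N − h)⁻¹ = Σ_j x^j (1 ⊗ N⁻¹)`. -/
def xHop (L : ℕ) [NeZero L] (M s₀ s₁ : ℝ) : Matrix ((ZMod L × ZMod L) × Fin 4) ((ZMod L × ZMod L) × Fin 4) ℂ :=
  ((1 : Matrix (ZMod L × ZMod L) (ZMod L × ZMod L) ℂ) ⊗ₖ CellKappa.nInv M s₀ s₁) * sHopTot L

/-- The torus walk sum of length `j` from site `v` to site `u`: the `4 × 4` spin block of `x^j (1 ⊗ N⁻¹)`. -/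
def torusWalk (L : ℕ) [NeZero L] (M s₀ s₁ : ℝ) (j : ℕ) (u v : ZMod L × ZMod L) : Matrix (Fin 4) (Fin 4) ℂ :=
  Matrix.of fun i k =>
    (xHop L M s₀ s₁ ^ j * ((1 : Matrix (ZMod L × ZMod L) (ZMod L × ZMod L) ℂ) ⊗ₖ CellKappa.nInv M s₀ s₁)) (u, i) (v, k)

/-- The `4 × 4` spin block `G(u, v)` of the free spin-site propagator `G = sFree⁻¹`. -/
def freeBlock (L : ℕ) [NeZero L] (M s₀ s₁ : ℝ) (u v : ZMod L × ZMod L) : Matrix (Fin 4) (Fin 4) ℂ :=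
  Matrix.of fun i k => (sFree L M s₀ s₁)⁻¹ (u, i) (v, k)

/-- The absolute bubble of the pair (cell link based at `x`, partner link based at `x'`): the four spin traces
`|tr(G(x₂, z₁) B₁ G(x₁, z₂) B₂)|` over the blocks `(z₂, x₂, B₂) ∈ {(x, x+e₁, P₋²), (x+e₁, x, P₊²)}` of the cell link and
`(z₁, x₁, B₁)` of the partner link — the torus counterpart, link by link, of the summand of `CellKappa.bubbleAbs` (seam and
orientation signs dropped, as they do not affect the absolute values). -/
def pairAbs (L : ℕ) [NeZero L] (M s₀ s₁ : ℝ) (x x' : ZMod L × ZMod L) : ℝ :=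
  ‖(freeBlock L M s₀ s₁ (x + (1, 0)) x' * CellKappa.pMinus 2 * freeBlock L M s₀ s₁ (x' + (1, 0)) x *
      CellKappa.pMinus 2).trace‖ +
    ‖(freeBlock L M s₀ s₁ (x + (1, 0)) (x' + (1, 0)) * CellKappa.pPlus 2 * freeBlock L M s₀ s₁ x' x *
      CellKappa.pMinus 2).trace‖ +
    ‖(freeBlock L M s₀ s₁ x x' * CellKappa.pMinus 2 * freeBlock L M s₀ s₁ (x' + (1, 0)) (x + (1, 0)) *
      CellKappa.pPlus 2).trace‖ +
    ‖(freeBlock L M s₀ s₁ x (x' + (1, 0)) * CellKappa.pPlus 2 * freeBlock L M s₀ s₁ x' (x + (1, 0)) *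
      CellKappa.pPlus 2).trace‖

/-- The lift sign `(−1)^(⌊z₁/L⌋ + ⌊z₂/L⌋)` of a planar point: the pure-gauge form of the antiperiodic seams on the
planar cover of the torus `(ℤ/L)²`. -/
def liftSign (L : ℕ) (z : ℤ × ℤ) : ℂ := (-1 : ℂ) ^ (z.1 / (L : ℤ) + z.2 / (L : ℤ))

/-- The projection of a planar point to the torus `(ℤ/L)²`. -/
def toTorus (L : ℕ) (z : ℤ × ℤ) : ZMod L × ZMod L := ((z.1 : ZMod L), (z.2 : ZMod L))

/-- The `ℓ¹` torus distance of a site of `(ℤ/L)²` to the origin. -/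
def tdist {L : ℕ} (v : ZMod L × ZMod L) : ℕ := v.1.valMinAbs.natAbs + v.2.valMinAbs.natAbs

/-- Regrouping of the index `(site, colour, spin)` of `freqOpR` as `((site, spin), colour)`. -/
def csEquiv (S : Type) : (S × Fin 4) × Fin 3 ≃ S × Fin 3 × Fin 4 where
  toFun p := (p.1.1, p.2, p.1.2)
  invFun q := ((q.1, q.2.2), q.2.1)
  left_inv _ := rfl
  right_inv _ := rfl

/-- Registered anchor theorem of this definitions file: the seam sign squares to one. -/
theorem seam_mul_seam : ∀ {L : ℕ} (a : ZMod L), seam a * seam a = 1 := by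
  intro L a
  unfold seam
  split_ifs <;> norm_num

end Summit.QuantumFields.QCD.Cruxes.CriticalLineDiamagnetism.ChessboardCellGain.CellWalk

end
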